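import Summits.CriticalPhenomena.Ising3DConformalLimit.Theses.PrimaryAtInfinity
import Summits.CriticalPhenomena.Ising3DConformalLimit.Theses.IsingEuclidUpgrade
import Summits.CriticalPhenomena.Ising3DConformalLimit.Theses.PerfectScreening
import Summits.CriticalPhenomena.Ising3DConformalLimit.Theses.AnomalousForcesInteraction
import Summits.CriticalPhenomena.Ising3DConformalLimit.Theorems.PrecisionLaplacianMoebiusLimitOfTwoPointLawMultipoleEdge
import Summits.CriticalPhenomena.Ising3DConformalLimit.Theorems.GaussianScaleMixtureRotationUpgradeFromTwoPointEdgeGaussianity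
import Summits.CriticalPhenomena.Ising3DConformalLimit.Theorems.HyperoctahedralRPTwoPointLimitIsotropicHolds
import Summits.CriticalPhenomena.Ising3DConformalLimit.Theorems.MoebiusLimitExists.Negative.ScaleRedundant
import Summits.CriticalPhenomena.Ising3DConformalLimit.Theorems.MoebiusLimitExists.Negative.FreeTranslations
import Summits.CriticalPhenomena.Ising3DConformalLimit.Theorems.AnomalousForcesInteractionDeltaLowerBound
import Literature.Barriers.CriticalPhenomena.TwoPointLawNotMoebius
import HarnessLib
import HarnessLib.Audit

/-!
# Crux `PrimaryAtInfinity.TwoPointPowerLawEta` (stmt-CriticalPhenomena-5354) — skeleton `Lines/birth.lean`, rev. 3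

Lead prover `prover-line-stmt-CriticalPhenomena-5354-c9-0`, 2026-08-17 (line `line-multipole-ward-nonsat-endpoint`
= birth cut, RESHAPED twice). Route `route-CriticalPhenomena-PrimaryAtInfinity` (rank-4 crux), sub-problem
`Ising3DConformalLimit`.

The crux (2PT), verbatim the route decl: for EVERY pointwise scaling limit `(ρ, S)` of the critical `ℤ³` Ising
correlators `criticalCorr 3` (`ρ > 0` on `(0,1]`) with non-degenerate two-point function there are `c > 0` and
`Δ > 1/2` with `S 2 ![a, b] = c‖a − b‖^(−2Δ)` for all `a ≠ b`.

## What the tree already proves for an ARBITRARY non-degenerate limit (no stub needed)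

Normalise `S` off `NonCoincident` (`MoebiusLimitExistsNegative.normalised_hasLimit/_nondeg`): the normalised family
is translation invariant (`isTranslationInvariant_normalised_of_limit`), scale covariant with some `Δ ∈ [1/2, 1]`
(`exists_scaleCovariant_normalised`), its two-point kernel is `O(3)` invariant
(`HyperoctahedralRPTwoPoint.kernel_rotation_invariant` — nine-mirror reflection positivity + X-ray/Mellin rigidity,
items 1979/1983/1984, landed), hence `S 2 ![a,b] = S 2 ![0,e₀]‖a−b‖^(−2Δ)`
(`RotationUpgradeFromTwoPointNegative.two_point_law`), and `U₄ ≢ 0 ⇒ 1/2 < Δ`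
(`NullLaplacianEdgeGaussianity.half_lt_delta_of_hasNontrivialU4`: at `Δ = 1/2` the limit is Gaussian at order 4).
So ISOTROPY and the PURE POWER LAW of the crux are theorems; its only open content is the strict inequality
`Δ > 1/2`, i.e. the exclusion of the Gaussian / `η = 0` edge.

## The cut (rev. 3/4): ONE open stub, by name = item 0636 of THIS route, plus one PROVED glue stub

* `stub_nonGaussian` = item stmt-CriticalPhenomena-0636 `PrimaryAtInfinity.IsingEuclidUpgradeR4NonGaussian` (by name;
  same body as `IsingEuclidUpgrade.IsingEuclidUpgradeR4NonGaussian`): every non-degenerate pointwise limit of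
  `criticalCorr 3` has `U₄ ≢ 0`. OPEN (non-triviality of Ising₃; false in `d ≥ 4`), but it is ALREADY an item of the
  route's assembly (rank 6), so for route `PrimaryAtInfinity` the crux 5354 is REDUNDANT given 0636.
* `stub_twoPointStructure` (glue G, PROVED in this file as `twoPointStructure` and landed by name in
  `Theorems/PrimaryAtInfinityTwoPointPowerLawEta.lean`; registered only so the glue rides `--supports` by name):
  every non-degenerate limit has a `Δ` with `U₄ ≢ 0 ⇒ 1/2 < Δ` and `S 2 ![a,b] = S 2 ![0,e₀]‖a−b‖^(−2Δ)`.

Composition `TwoPointPowerLawEta_of_stubs' : 0636 → G → crux` and `TwoPointPowerLawEta_of : 0636 → crux` are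
sorry-free below (the glue lands, with the alternative edges `EtaPositive (2600) → 5354`,
`(∀ η, HasIsingExponentEta 3 η → 0 < η) → 5354`, `¬ HasIsingExponentEta 3 0 → 5354`, the iff-characterisation
"5354 ⇔ every non-degenerate limit has Δ > 1/2", the converse "5354 + one limit ⇒ η > 0", and the route assembly
with 5354 removed, as `Theorems/PrimaryAtInfinityTwoPointPowerLawEta.lean`, `--supports stmt-CriticalPhenomena-5354`).

History: rev. 1 (planner, birth) `5354 ⇐ 0634 ∧ 1342` (landed edge, kept below as `TwoPointPowerLawEta_of_birth`);
rev. 2 (this lead) `5354 ⇐ asymptotic isotropy ∧ (η > 0 if η exists)` — superseded within the hour once the tree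
survey showed limit isotropy is landed (route HyperoctahedralRP) and `Δ = 1/2 ⇒ U₄ ≡ 0` is landed (route
GaussianScaleMixture). Disproof used: none exists for this crux.
-/

noncomputable section

namespace Summit.CriticalPhenomena.Ising3DConformalLimit.Cruxes.TwoPointPowerLawEta.Birth

open Filter Topology Literature.Probability.LatticeModels
open Literature.Barriers.CriticalPhenomena.ScaleNotMoebius (axisUnit zero_axisUnit_mem_nonCoincident)
open Summit.CriticalPhenomena.Ising3DConformalLimit.MoebiusLimitExistsNegative
  (normalised_hasLimit normalised_nondeg hasNontrivialU4_normalised_iff exists_scaleCovariant_normalised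
   isTranslationInvariant_normalised_of_limit)
open Summit.CriticalPhenomena.Ising3DConformalLimit.HyperoctahedralRPTwoPoint (kernel_rotation_invariant)
open Summit.CriticalPhenomena.Ising3DConformalLimit.RotationUpgradeFromTwoPointNegative (two_point_law)
open Summit.CriticalPhenomena.Ising3DConformalLimit.Cruxes.RotationUpgradeFromTwoPoint.NullLaplacianEdgeGaussianity
  (half_lt_delta_of_hasNontrivialU4)
open Summit.CriticalPhenomena.Ising3DConformalLimit.Theses

/-- **The one stub = item stmt-CriticalPhenomena-0636, by name** (route `PrimaryAtInfinity` spelling): every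
non-degenerate pointwise scaling limit of `criticalCorr 3` (`ρ > 0` on `(0,1]`) has non-trivial connected four-point
function `U₄ ≢ 0` on non-coincident quadruples. OPEN (non-Gaussianity of Ising₃; Aizenman 1982 / ADC 2021 settle
only `d ≥ 4`, where it FAILS). -/
theorem stub_nonGaussian :
    Summit.CriticalPhenomena.Ising3DConformalLimit.Theses.PrimaryAtInfinity.IsingEuclidUpgradeR4NonGaussian := by
  sorry

open Classical in
/-- **Glue stub G (PROVABLE NOW — proved sorry-free below as `twoPointStructure`, and landed by name in
`Theorems/PrimaryAtInfinityTwoPointPowerLawEta.lean`): the two-point structure of an arbitrary non-degenerate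
limit.** For every pointwise scaling limit `(ρ, S)` of `criticalCorr 3` (`ρ > 0` on `(0,1]`, non-degenerate `S₂`)
there is `Δ` with `U₄ ≢ 0 ⇒ 1/2 < Δ` and the isotropic pure power law `S 2 ![a,b] = S 2 ![0,e₀]·‖a−b‖^(−2Δ)`
(`a ≠ b`). Registered as a stub only so that the glue file can ride `--supports` by name. -/
theorem stub_twoPointStructure :
    ∀ (ρ : ℝ → ℝ) (S : CorrFamily 3), (∀ δ ∈ Set.Ioc (0:ℝ) 1, 0 < ρ δ) →
      HasPointwiseScalingLimit (criticalCorr 3) ρ S → IsNondegenerateTwoPoint S →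
      ∃ Δ : ℝ, (HasNontrivialU4 S → 1 / 2 < Δ) ∧
        ∀ a b : EuclideanSpace ℝ (Fin 3), a ≠ b →
          S 2 ![a, b] = S 2 ![0, EuclideanSpace.single 0 1] * ‖a - b‖ ^ (-(2 * Δ)) := by
  sorry

open Classical in
/-- **Proof of the glue stub G** from landed tree theorems: normalise the limit; translation invariance, scale
covariance (`Δ`), two-point isotropy and the two-point law are tree theorems; `U₄ ≢ 0` (read through
`hasNontrivialU4_normalised_iff`) excludes the edge `Δ = 1/2` by `half_lt_delta_of_hasNontrivialU4`. -/
theorem twoPointStructure :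
    ∀ (ρ : ℝ → ℝ) (S : CorrFamily 3), (∀ δ ∈ Set.Ioc (0:ℝ) 1, 0 < ρ δ) →
      HasPointwiseScalingLimit (criticalCorr 3) ρ S → IsNondegenerateTwoPoint S →
      ∃ Δ : ℝ, (HasNontrivialU4 S → 1 / 2 < Δ) ∧
        ∀ a b : EuclideanSpace ℝ (Fin 3), a ≠ b →
          S 2 ![a, b] = S 2 ![0, EuclideanSpace.single 0 1] * ‖a - b‖ ^ (-(2 * Δ)) := by
  intro ρ S hρ hlim hnd
  set S' : CorrFamily 3 := fun n x => if x ∈ NonCoincident 3 n then S n x else 0 with hS'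
  have hlim' : HasPointwiseScalingLimit (criticalCorr 3) ρ S' := normalised_hasLimit hlim
  have hnd' : IsNondegenerateTwoPoint S' := normalised_nondeg hnd
  have hnorm' : ∀ n z, z ∉ NonCoincident 3 n → S' n z = 0 := fun n z hz => if_neg hz
  have htr' : IsTranslationInvariant S' := isTranslationInvariant_normalised_of_limit hlim
  obtain ⟨Δ, -, hsc'⟩ := exists_scaleCovariant_normalised hρ hlim hnd
  have hiso' : ∀ (R : EuclideanSpace ℝ (Fin 3) ≃ₗᵢ[ℝ] EuclideanSpace ℝ (Fin 3)) (x : EuclideanSpace ℝ (Fin 3)),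
      x ≠ 0 → S' 2 ![0, R x] = S' 2 ![0, x] :=
    fun R x _ => kernel_rotation_invariant hρ hlim' hnd' htr' hsc' R x
  refine ⟨Δ, fun hU4 => ?_, fun a b hab => ?_⟩
  · exact half_lt_delta_of_hasNontrivialU4 hρ hlim' hnorm' hnd' htr' hsc' hiso'
      (hasNontrivialU4_normalised_iff.2 hU4)
  · have hlaw := two_point_law htr' hsc' hiso' hab
    have h1 : S' 2 ![a, b] = S 2 ![a, b] := if_pos (pair_mem_nonCoincident hab)
    have h2 : S' 2 ![0, axisUnit] = S 2 ![0, axisUnit] := if_pos zero_axisUnit_mem_nonCoincident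
    rw [h1, h2] at hlaw
    rw [hlaw, mul_comm]
    rfl

/-- **Composition of the registered stubs (kernel-checked): item 0636 ∧ G → crux 5354**, concluding the route
decl `Theses.PrimaryAtInfinity.TwoPointPowerLawEta` BY NAME; `c = S 2 ![0,e₀] > 0` by non-degeneracy. -/
theorem TwoPointPowerLawEta_of_stubs'
    (h0636 : Summit.CriticalPhenomena.Ising3DConformalLimit.Theses.PrimaryAtInfinity.IsingEuclidUpgradeR4NonGaussian)
    (hG : ∀ (ρ : ℝ → ℝ) (S : CorrFamily 3), (∀ δ ∈ Set.Ioc (0:ℝ) 1, 0 < ρ δ) →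
      HasPointwiseScalingLimit (criticalCorr 3) ρ S → IsNondegenerateTwoPoint S →
      ∃ Δ : ℝ, (HasNontrivialU4 S → 1 / 2 < Δ) ∧
        ∀ a b : EuclideanSpace ℝ (Fin 3), a ≠ b →
          S 2 ![a, b] = S 2 ![0, EuclideanSpace.single 0 1] * ‖a - b‖ ^ (-(2 * Δ))) :
    Summit.CriticalPhenomena.Ising3DConformalLimit.Theses.PrimaryAtInfinity.TwoPointPowerLawEta := by
  intro ρ S hρ hlim hnd
  obtain ⟨Δ, hgt, hlaw⟩ := hG ρ S hρ hlim hnd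
  exact ⟨S 2 ![0, EuclideanSpace.single 0 1], Δ, hnd _ zero_axisUnit_mem_nonCoincident,
    hgt (h0636 ρ S hρ hlim hnd), hlaw⟩

open Classical in
/-- **Composition (kernel-checked, sorry-free): item 0636 → crux 5354**, concluding the route decl
`Theses.PrimaryAtInfinity.TwoPointPowerLawEta` BY NAME. Normalise the limit; translation invariance, scale
covariance (`Δ`), two-point isotropy and the two-point law are tree theorems; `U₄ ≢ 0` (the stub, read through
`hasNontrivialU4_normalised_iff`) excludes the edge `Δ = 1/2` by `half_lt_delta_of_hasNontrivialU4`;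
`c = S 2 ![0,e₀] > 0` by non-degeneracy. -/
theorem TwoPointPowerLawEta_of
    (h0636 : Summit.CriticalPhenomena.Ising3DConformalLimit.Theses.PrimaryAtInfinity.IsingEuclidUpgradeR4NonGaussian) :
    Summit.CriticalPhenomena.Ising3DConformalLimit.Theses.PrimaryAtInfinity.TwoPointPowerLawEta := by
  intro ρ S hρ hlim hnd
  set S' : CorrFamily 3 := fun n x => if x ∈ NonCoincident 3 n then S n x else 0 with hS'
  have hlim' : HasPointwiseScalingLimit (criticalCorr 3) ρ S' := normalised_hasLimit hlim
  have hnd' : IsNondegenerateTwoPoint S' := normalised_nondeg hnd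
  have hnorm' : ∀ n z, z ∉ NonCoincident 3 n → S' n z = 0 := fun n z hz => if_neg hz
  have htr' : IsTranslationInvariant S' := isTranslationInvariant_normalised_of_limit hlim
  obtain ⟨Δ, -, hsc'⟩ := exists_scaleCovariant_normalised hρ hlim hnd
  have hiso' : ∀ (R : EuclideanSpace ℝ (Fin 3) ≃ₗᵢ[ℝ] EuclideanSpace ℝ (Fin 3)) (x : EuclideanSpace ℝ (Fin 3)),
      x ≠ 0 → S' 2 ![0, R x] = S' 2 ![0, x] :=
    fun R x _ => kernel_rotation_invariant hρ hlim' hnd' htr' hsc' R x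
  have hΔ : 1 / 2 < Δ :=
    half_lt_delta_of_hasNontrivialU4 hρ hlim' hnorm' hnd' htr' hsc' hiso'
      (hasNontrivialU4_normalised_iff.2 (h0636 ρ S hρ hlim hnd))
  refine ⟨S 2 ![0, axisUnit], Δ, hnd _ zero_axisUnit_mem_nonCoincident, hΔ, fun a b hab => ?_⟩
  have hlaw := two_point_law htr' hsc' hiso' hab
  have h1 : S' 2 ![a, b] = S 2 ![a, b] := if_pos (pair_mem_nonCoincident hab)
  have h2 : S' 2 ![0, axisUnit] = S 2 ![0, axisUnit] := if_pos zero_axisUnit_mem_nonCoincident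
  rw [h1, h2] at hlaw
  rw [hlaw, mul_comm]

/-- The registered stubs discharge the hypotheses verbatim (the skeleton as a conditional proof of the crux; not
closed: it rests on the `sorry` of `stub_nonGaussian` — `stub_twoPointStructure` is proved as `twoPointStructure`). -/
theorem TwoPointPowerLawEta_of_stubs :
    Summit.CriticalPhenomena.Ising3DConformalLimit.Theses.PrimaryAtInfinity.TwoPointPowerLawEta :=
  TwoPointPowerLawEta_of_stubs' stub_nonGaussian stub_twoPointStructure

/-- The same composition with the glue stub discharged in-file (only `stub_nonGaussian` = item 0636 remains). -/
theorem TwoPointPowerLawEta_of_stub_nonGaussian :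
    Summit.CriticalPhenomena.Ising3DConformalLimit.Theses.PrimaryAtInfinity.TwoPointPowerLawEta :=
  TwoPointPowerLawEta_of_stubs' stub_nonGaussian twoPointStructure

/-- **Alternative edge, landed glue: item 2600 `EtaPositive` → crux** (`DeltaLowerBound_proof`: a lattice bound
`G ≤ C‖x‖^{-(1+κ)}` gives `1 + κ ≤ 2Δ` for the normalised limit). -/
theorem TwoPointPowerLawEta_of_etaPositive
    (h2600 : Summit.CriticalPhenomena.Ising3DConformalLimit.Theses.AnomalousForcesInteraction.EtaPositive) :
    Summit.CriticalPhenomena.Ising3DConformalLimit.Theses.PrimaryAtInfinity.TwoPointPowerLawEta := by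
  classical
  intro ρ S hρ hlim hnd
  set S' : CorrFamily 3 := fun n x => if x ∈ NonCoincident 3 n then S n x else 0 with hS'
  have hlim' : HasPointwiseScalingLimit (criticalCorr 3) ρ S' := normalised_hasLimit hlim
  have hnd' : IsNondegenerateTwoPoint S' := normalised_nondeg hnd
  have htr' : IsTranslationInvariant S' := isTranslationInvariant_normalised_of_limit hlim
  obtain ⟨Δ, -, hsc'⟩ := exists_scaleCovariant_normalised hρ hlim hnd
  have hiso' : ∀ (R : EuclideanSpace ℝ (Fin 3) ≃ₗᵢ[ℝ] EuclideanSpace ℝ (Fin 3)) (x : EuclideanSpace ℝ (Fin 3)),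
      x ≠ 0 → S' 2 ![0, R x] = S' 2 ![0, x] :=
    fun R x _ => kernel_rotation_invariant hρ hlim' hnd' htr' hsc' R x
  obtain ⟨κ, C, hκ, hbd⟩ := h2600
  have hΔ : 1 / 2 < Δ := by
    have h := Summit.CriticalPhenomena.Ising3DConformalLimit.Theorems.DeltaLowerBound_proof (1 + κ) C ρ Δ S' hbd hρ
      hlim' hnd' hsc'
    linarith
  refine ⟨S 2 ![0, axisUnit], Δ, hnd _ zero_axisUnit_mem_nonCoincident, hΔ, fun a b hab => ?_⟩
  have hlaw := two_point_law htr' hsc' hiso' hab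
  have h1 : S' 2 ![a, b] = S 2 ![a, b] := if_pos (pair_mem_nonCoincident hab)
  have h2 : S' 2 ![0, axisUnit] = S 2 ![0, axisUnit] := if_pos zero_axisUnit_mem_nonCoincident
  rw [h1, h2] at hlaw
  rw [hlaw, mul_comm]

/-- **The birth edge, landed** (for the record): item 0634 → item 1342 → crux, the tree theorem
`PrecisionLaplacianMoebiusLimitOfTwoPointLaw.twoPointPowerLawEta_of_nonSaturation`. -/
theorem TwoPointPowerLawEta_of_birth
    (hP : Summit.CriticalPhenomena.Ising3DConformalLimit.Theses.IsingEuclidUpgrade.IsingEuclidUpgradeR2RotInvPowerLaw)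
    (hNS : Summit.CriticalPhenomena.Ising3DConformalLimit.Theses.PerfectScreening.NonSaturation) :
    Summit.CriticalPhenomena.Ising3DConformalLimit.Theses.PrimaryAtInfinity.TwoPointPowerLawEta :=
  Summit.CriticalPhenomena.Ising3DConformalLimit.PrecisionLaplacianMoebiusLimitOfTwoPointLaw.twoPointPowerLawEta_of_nonSaturation
    hNS hP

end Summit.CriticalPhenomena.Ising3DConformalLimit.Cruxes.TwoPointPowerLawEta.Birth

end
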